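import Summits.CriticalPhenomena.Ising3D.TaylorTableOddHeadParts2
import Summits.CriticalPhenomena.Ising3D.TaylorTableHeadPartsRows
import HarnessLib

/-!
# Merged-2 odd head parts and final: rows AND tables congruence (blanked rows / blanked table positions) and monotonicity in `J` (BOX 3 claim glue)
(cell `pub-ising3x`, boot-1 gen 20 + lead gen 28, 2026-08-24; RULING R28-γ module of record «TaylorTableHeadParts2Congr» = boot rows draft 09de9767… + lead tables block ff19d224…; HONEST FRAMING: lottery ticket; floor = tightest
certified 3D Ising CFT bounds; no exact-solution claim without a proof.)

The merged-2 replay files of record (oddcell_replay4) carry, like the order-0 files, a PER-FILE row object `R♭` whose unread rows are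
BLANK; the certificate's `H2.R` is the full `J = 56` object.  This file is the merged-2 twin of `TaylorTableHeadPartsRows` /
`TaylorTableHeadFinalMonoJ`:
* `term2_congr_rows` / `slice2_congr_rows`: `HeadParts2.term2` reads `R` only through `R.S`, `R.Wσ`, `R.Wε` (and `R.Wt`) and the ONE row
  literal `R.lit q.2` of its term — so it is unchanged under replacing the rows by ones agreeing on the slice;
* **`oddPartOK2_congr_rows`**: `OddRowsAgreeOn R R' slice` (same `S`, same literal at every read `j`) + `Wσ, Wε` equal ⇒
  `oddPartOK2 R … p = oddPartOK2 R' … p` (unlike the order-0 part check, the merged-2 part reads the box half-widths);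
* **`oddPartOK2_congr_tables`** / `oddPartOK2_transfer` (lead g28): `Tables2AgreeOn` at the slice's positions `nF − n` for the three
  τ-triple tables — the merged-2 GROUP files check parts against BLANKED literal tables whose read positions are literal-identical (κ2) to
  the chunk files', which compose to `HRTMAB2.rows2` by `rows2_add_of_chunk` (TaylorTableOddCoeffTM2Chunks);
* `oddHeadFinalOK2_congr_rows` (equal `S, J, Wσ, Wε`) and **`oddHeadFinalOK2_mono_J`** (`R.J ≤ R'.J`): the final reads no rows and its
  structural half is monotone in `J` (`C.F.all (·.2 < R.J)`).
Elementary (unfolding + list induction). [folklore]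
-/

namespace Summit.CriticalPhenomena.Ising3D
namespace HeadParts2

open Literature.Analysis.ValidatedNumerics Literature.Analysis.ValidatedNumerics.PolyMP
open Literature.Analysis.ValidatedNumerics.NumericsMP
open Literature.MathematicalPhysics.QuantumFieldTheory.ConformalBootstrap3D
open Literature.MathematicalPhysics.QuantumFieldTheory.ConformalBootstrap3D.HRTM
open HRTMAB2 (rowEntry2)

/-- `term2` depends on the row object only through `S`, `Wσ`, `Wε` and the row literal at the term's own `j`. [folklore] -/
theorem term2_congr_rows {R R' : OddHeadRowsΔ} (hS : R.S = R'.S) (hWσ : R.Wσ = R'.Wσ) (hWε : R.Wε = R'.Wε) (C : EvenCellTM)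
    (TS TP TM : List (List HRTMAB2.TPoly)) (sc : Scal2) (Wn : ℤ) (Wd : ℕ) (q : ℕ × ℕ) (hq : R.lit q.2 = R'.lit q.2) :
    term2 R C TS TP TM sc Wn Wd q = term2 R' C TS TP TM sc Wn Wd q := by
  have ht : R.Wt = R'.Wt := by rw [OddHeadRowsΔ.Wt, OddHeadRowsΔ.Wt, hWσ, hWε]
  simp only [term2, hS, hWσ, hWε, ht, hq]

/-- `slice2` is unchanged under rows agreeing at every read `j` (same `S`, `Wσ`, `Wε`). [folklore] -/
theorem slice2_congr_rows {R R' : OddHeadRowsΔ} (hS : R.S = R'.S) (hWσ : R.Wσ = R'.Wσ) (hWε : R.Wε = R'.Wε) (C : EvenCellTM)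
    (TS TP TM : List (List HRTMAB2.TPoly)) (sc : Scal2) (Wn : ℤ) (Wd : ℕ) :
    ∀ sl : List (ℕ × ℕ), (∀ q ∈ sl, R.lit q.2 = R'.lit q.2) →
      slice2 R C TS TP TM sc Wn Wd sl = slice2 R' C TS TP TM sc Wn Wd sl
  | [], _ => rfl
  | q :: qs, h => by
      simp only [slice2, term2_congr_rows hS hWσ hWε C TS TP TM sc Wn Wd q (h q List.mem_cons_self),
        slice2_congr_rows hS hWσ hWε C TS TP TM sc Wn Wd qs fun q' hq' => h q' (List.mem_cons_of_mem _ hq')]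

/-- **The merged-2 part check is invariant under replacing the rows by ones agreeing on the part's slice** (blanked rows), given the
same box half-widths. [folklore] -/
theorem oddPartOK2_congr_rows {R R' : OddHeadRowsΔ} (C : EvenCellTM) (TS TP TM : List (List HRTMAB2.TPoly)) (sc : Scal2) (Wn : ℤ)
    (Wd : ℕ) (p : HeadPart2) (h : OddRowsAgreeOn R R' ((C.F.drop p.t0).take p.count)) (hWσ : R.Wσ = R'.Wσ) (hWε : R.Wε = R'.Wε) :
    oddPartOK2 R C TS TP TM sc Wn Wd p = oddPartOK2 R' C TS TP TM sc Wn Wd p := by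
  simp only [oddPartOK2, slice2_congr_rows h.1 hWσ hWε C TS TP TM sc Wn Wd _ h.2]

/-- The structural half of the merged-2 final is monotone in the row count. [folklore] -/
theorem oddHeadStructOK2_mono_J {R R' : OddHeadRowsΔ} (hJ : R.J ≤ R'.J) (C : EvenCellTM) (ps : List HeadPart2)
    (h : oddHeadStructOK2 R C ps = true) : oddHeadStructOK2 R' C ps = true := by
  simp only [oddHeadStructOK2, Bool.and_eq_true, List.all_eq_true, decide_eq_true_eq] at h ⊢
  obtain ⟨⟨⟨⟨hD, hpiv⟩, hF⟩, hch⟩, hcnt⟩ := h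
  exact ⟨⟨⟨⟨hD, hpiv⟩, fun q hq => lt_of_lt_of_le (hF q hq) hJ⟩, hch⟩, hcnt⟩

/-- **The merged-2 final reads no rows**: it depends on `R` only through `S, J, Wσ, Wε`. [folklore] -/
theorem oddHeadFinalOK2_congr_rows {R R' : OddHeadRowsΔ} (hS : R.S = R'.S) (hJ : R.J = R'.J) (hWσ : R.Wσ = R'.Wσ)
    (hWε : R.Wε = R'.Wε) (dP : ℕ) (C : EvenCellTM) (ps : List HeadPart2) :
    oddHeadFinalOK2 R dP C ps = oddHeadFinalOK2 R' dP C ps := by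
  simp only [oddHeadFinalOK2, oddHeadStructOK2, hS, hJ, hWσ, hWε]

/-- **The merged-2 final transfers from a row object with fewer rows to one with more rows** (same `S`, `Wσ`, `Wε`; `R.J ≤ R'.J`).
[folklore] -/
theorem oddHeadFinalOK2_mono_J {R R' : OddHeadRowsΔ} (hS : R.S = R'.S) (hJ : R.J ≤ R'.J) (hWσ : R.Wσ = R'.Wσ) (hWε : R.Wε = R'.Wε)
    (dP : ℕ) (C : EvenCellTM) (ps : List HeadPart2) (h : oddHeadFinalOK2 R dP C ps = true) :
    oddHeadFinalOK2 R' dP C ps = true := by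
  simp only [oddHeadFinalOK2, Bool.and_eq_true] at h ⊢
  refine ⟨oddHeadStructOK2_mono_J hJ C ps h.1, ?_⟩
  rw [← hS, ← hWσ, ← hWε]
  exact h.2

/-! ### Table-position congruence for the merged-2 evaluator (analogue of TaylorTableHeadPartsCongr for TPoly tables) -/

/-- Two merged-2 tables AGREE on a slice: equal rows at every position `nF − n` the slice reads. [folklore] -/
def Tables2AgreeOn (t t' : List (List HRTMAB2.TPoly)) (nF : ℕ) (sl : List (ℕ × ℕ)) : Prop :=
  ∀ q ∈ sl, t.getD (nF - q.1) [] = t'.getD (nF - q.1) []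

/-- `rowEntry2` reads one position. [folklore] -/
theorem rowEntry2_congr {t t' : List (List HRTMAB2.TPoly)} {nF n : ℕ} (h : t.getD (nF - n) [] = t'.getD (nF - n) []) (j : ℕ) :
    rowEntry2 t nF n j = rowEntry2 t' nF n j := by
  unfold rowEntry2; rw [h]

/-- `term2` reads each table only at position `nF − q.1`. [folklore] -/
theorem term2_congr_tables (R : OddHeadRowsΔ) (C : EvenCellTM) {TS TS' TP TP' TM TM' : List (List HRTMAB2.TPoly)} (sc : Scal2) (Wn : ℤ) (Wd : ℕ)
    (q : ℕ × ℕ) (hS : TS.getD (C.nF - q.1) [] = TS'.getD (C.nF - q.1) []) (hP : TP.getD (C.nF - q.1) [] = TP'.getD (C.nF - q.1) [])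
    (hM : TM.getD (C.nF - q.1) [] = TM'.getD (C.nF - q.1) []) :
    term2 R C TS TP TM sc Wn Wd q = term2 R C TS' TP' TM' sc Wn Wd q := by
  simp only [term2, rowEntry2_congr hS, rowEntry2_congr hP, rowEntry2_congr hM]

/-- `slice2` congruence in the tables. [folklore] -/
theorem slice2_congr_tables (R : OddHeadRowsΔ) (C : EvenCellTM) {TS TS' TP TP' TM TM' : List (List HRTMAB2.TPoly)} (sc : Scal2) (Wn : ℤ) (Wd : ℕ) :
    ∀ sl : List (ℕ × ℕ), Tables2AgreeOn TS TS' C.nF sl → Tables2AgreeOn TP TP' C.nF sl → Tables2AgreeOn TM TM' C.nF sl →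
      slice2 R C TS TP TM sc Wn Wd sl = slice2 R C TS' TP' TM' sc Wn Wd sl
  | [], _, _, _ => by simp only [slice2]
  | q :: qs, hS, hP, hM => by
      simp only [slice2, term2_congr_tables R C sc Wn Wd q (hS q List.mem_cons_self) (hP q List.mem_cons_self) (hM q List.mem_cons_self),
        slice2_congr_tables R C sc Wn Wd qs (fun q' h => hS q' (List.mem_cons_of_mem q h)) (fun q' h => hP q' (List.mem_cons_of_mem q h))
          (fun q' h => hM q' (List.mem_cons_of_mem q h))]

/-- **The merged-2 part check from BLANKED literal tables**: tables that agree with the certificate's tables on the part's slice give the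
same check. [folklore] -/
theorem oddPartOK2_congr_tables (R : OddHeadRowsΔ) (C : EvenCellTM) {TS TS' TP TP' TM TM' : List (List HRTMAB2.TPoly)} (sc : Scal2) (Wn : ℤ) (Wd : ℕ)
    (p : HeadPart2) (hS : Tables2AgreeOn TS TS' C.nF ((C.F.drop p.t0).take p.count)) (hP : Tables2AgreeOn TP TP' C.nF ((C.F.drop p.t0).take p.count))
    (hM : Tables2AgreeOn TM TM' C.nF ((C.F.drop p.t0).take p.count)) :
    oddPartOK2 R C TS TP TM sc Wn Wd p = oddPartOK2 R C TS' TP' TM' sc Wn Wd p := by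
  simp only [oddPartOK2, slice2_congr_tables R C sc Wn Wd _ hS hP hM]

/-- **Transfer of a merged-2 group-file certificate to the certificate's data**: blanked rows agreeing on the part's slice, blanked tables
agreeing on the part's slice, same width scalars. [folklore] -/
theorem oddPartOK2_transfer {R R' : OddHeadRowsΔ} (C : EvenCellTM) {TS TS' TP TP' TM TM' : List (List HRTMAB2.TPoly)} (sc : Scal2) (Wn : ℤ) (Wd : ℕ)
    (p : HeadPart2) (hR : OddRowsAgreeOn R R' ((C.F.drop p.t0).take p.count)) (hWσ : R.Wσ = R'.Wσ) (hWε : R.Wε = R'.Wε)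
    (hS : Tables2AgreeOn TS TS' C.nF ((C.F.drop p.t0).take p.count)) (hP : Tables2AgreeOn TP TP' C.nF ((C.F.drop p.t0).take p.count))
    (hM : Tables2AgreeOn TM TM' C.nF ((C.F.drop p.t0).take p.count)) (h : oddPartOK2 R C TS TP TM sc Wn Wd p = true) :
    oddPartOK2 R' C TS' TP' TM' sc Wn Wd p = true := by
  rw [← oddPartOK2_congr_tables R' C sc Wn Wd p hS hP hM, ← oddPartOK2_congr_rows C TS TP TM sc Wn Wd p hR hWσ hWε]; exact h

end HeadParts2
end Summit.CriticalPhenomena.Ising3D
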